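import Summits.BirchSwinnertonDyer.BirchSwinnertonDyer.Theorems.SignedLowerHalvesSmallImageLowerHalfBothSignsMuRiderTwoParityLayersThree
import Summits.BirchSwinnertonDyer.BirchSwinnertonDyer.Theorems.ConjSpanGenAllLevels
import Literature.NumberTheory.Automorphic.CongruenceSubgroupPropertySL2AwayHolds
import Literature.NumberTheory.EllipticCurves.PAdicLFunctionDistributionProofs
import HarnessLib

/-!
# Route `SignedLowerHalves`, child crux L `SmallImageLowerHalfBothSigns` (item stmt-BirchSwinnertonDyer-23599), line
# `birth_acns` v14, stub `stub_muBothSigns_ns`: the PARITY-SPAN ROAD at `p = 3` — each SIGN of the both-signs rider is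
# ONE PARITY HALF of the tree's THEOREM B (cell `bsd-ssimc`, width seat `bsd-line-slh-p3-w2` gen 3 under LEAD slh-p3;
# helper `--supports 23599`; THEOREMS ONLY; part 4a of this seat's series, companion of `…MuRiderTwoLayersThree` /
# `…MuRiderTwoParityLayersThree`; part 4b = `…MuRiderParitySpanThreeSigns.lean`)

HONEST FRAMING.  Child L, crux 4, the stub and BSD are OPEN and NOT proved by anything here; no definition, no named
fact, no `sorry`.  Gen 2 (parts 2–3) reduced the `p = 3` slice of the both-signs rider to LS-0(3) = «every level prime to
`3` satisfies the SINGLE-LAYER span `LayerEisSpanModGen N 3 m` at all large layers» (Sun 2007 §4 Conj. 8 at `(ℓ,p) = (3,3)`,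
Eisenstein-refined; per pair: TWO CONSECUTIVE certified layers `LayerEisSpanTwoModGen N 3`).  This file records the
WEAKER sufficient input the method really needs — a split of THEOREM B's generating set by the PARITY of the layer:

* §0 `S_even(N,p) = {γ ∈ Γ₀(N) : |d_γ| = p^{2m}}` — LITERALLY the tree's good set `{γ | IsGoodAt (p²) γ}` — and
  `S_odd(N,p) = {γ : |d_γ| = p^{2m+1}}`; `S_even ∪ S_odd = {γ | IsGoodAt p γ}` (`setOf_isGoodAt_eq_union`), so
  `SpanModBy N p (S_even ∪ S_odd)` IS THEOREM B (Vaserstein over `ℤ[1/p]`, tree theorem; `spanModBy_union_parity`,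
  input-free), while `SpanModBy N p S_even` / `SpanModBy N p S_odd` («the even-layer / odd-layer closed winding classes
  `{0 → b/p^{2m}}` resp. `{0 → b/p^{2m+1}}` ALONE span `pr Γ₁(N)` in `H₁(X₀(N);𝔽_p)` up to the Eisenstein part») are its
  two halves.  Each half is implied by ONE certified layer of that parity (`spanModBy_even/odd_of_layerEisSpanModGen`,
  monotonicity of `SpanModBy`), hence both by `LayerEisSpanTwoModGen` (`spanModBy_parity_of_layerEisSpanTwoModGen`);
  the converse is not claimed (a union of infinitely many layers may span where no single layer does).
* §1 (`p` odd, any curve, x8's PROVED generic bridge `PrintX8VerticalStevens.bridgeBy`): a spanning test set of shape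
  `{γ : |d_γ| = p^{e m}}` carries a UNIT winding-symbol difference `[b/p^{e m}]⁺_f − [0]⁺_f` with `e m ≥ 1`, `p ∤ b`
  (`exists_unit_layer_of_spanModBy_shape`; layer `0` is excluded by the `ℤ`-periodicity of `[·]⁺_f`); hence the even
  half gives a unit at an EVEN layer `2m ≥ 2`, the odd half one at an ODD layer (`exists_unit_even/oddLayer_of_spanModBy`).
* §2 (`p = 3` good, `a₃ = 0`, `f` any newform, any Sprung = Pollack pair): ONE UNIT LAYER OF GIVEN PARITY ⟹ ONE COLOUR —
  even layer ⟹ `L♯ = L⁺ ≢ 0 (mod 3)`, odd layer ⟹ `L♭ = L⁻ ≢ 0 (mod 3)` (`red_sharp_ne_zero_of_unit_evenLayer_three`,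
  `red_flat_ne_zero_of_unit_oddLayer_three`; unit case `ord₃[0]⁺ = 0` by `isUnit_chromaticL_of_frobeniusTrace_eq_zero`,
  otherwise the integral `θ_{m−1} ≢ 0` of `exists_integral_mazurTate_of_unitLayer_three` and x8's
  `red_sharp/flat_ne_zero_of_mazurTate_odd/even`).  Part 4b turns the halves into signs, the node and the stub's text.

READING FOR THE PEN (D-0014, numbers): THEOREM B = «the union spans» is PROVED and is worth `min(μ⁺, μ⁻) = 0`
(`LargeImageMuFloor.signedMuFloor_three`); «each parity half spans» is worth `μ⁺ = μ⁻ = 0` at `p = 3` on all 100 `p = 3`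
pairs of child L's census (indeed on every `a₃ = 0` curve).  The orbit trick behind THEOREM B cannot see the parity (no
subgroup `B₂` of the Borel of `SL₂(ℤ[1/3])` has `B₂·0 ⊆` even-layer cusps and `Γ₀(N)·B₂ = Γ₀(N; ℤ[1/3])`), and `T₃` links
layers `n ± 1` only, so on an `a₃ = 0` eigen-line the two parities decouple — the halves are new input, OPEN like Sun's
Conj. 8 but implied by it and by every single-layer certificate of the right parity (x8 kit j287967: `LayerEisSpanTwoModGen N 3`
at 657/657 levels `N ≤ 1000`).  No equal-`μ` theorem (`μ(X⁺) = μ(X⁻)` or `μ(L⁺) = μ(L⁻)`) exists in print to trade one half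
for the other (B.D. Kim 2013 Thm. 1.1/1.2 = no finite submodule / Euler characteristic; Kitajima–Otsuki 2018 idem;
Hamidi–Ray 2021 = Conj. A consequences).

References: [Sun2007] §4 (8), Conj. 8; [Manin1972] Prop. 1.4; [Vaserstein1972SL2] Theorem; [MazurTateTeitelbaum1986Invent]
§I.10 (10.1); [Pollack2003] Prop. 6.9–6.10, 6.18; [Sprung2017] §3.1, Cor. 4.4, 4.10–4.11; [Kobayashi2003] Thm. 3.2, (3.4)–(3.6);
[PerrinRiou2003] §6.1 Conj. 6.1.1; tree: `Rank1Residual/CyclotomicWindingSpan.lean` §3 (`SpanModBy`),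
`Theorems/PrintX8VerticalStevensBridgeBy.lean` / `…Bridge.lean` (`bridgeBy`), `Theorems/PrintX8MazurTateMuRider.lean`,
`Theorems/ConjSpanGenAllLevels*.lean` (THEOREM B), parts 1–3 of this seat (p688805, p689115, p689622).
-/

-- D-0017: single-problem summit, the namespace repeats the problem name by design.
set_option linter.dupNamespace false
set_option autoImplicit false

noncomputable section

open scoped Classical MatrixGroups ModularForm

open CongruenceSubgroup Polynomial WeierstrassCurve Literature.NumberTheory.EllipticCurves
  Literature.NumberTheory.EllipticCurves.ModularForms
  Literature.NumberTheory.EllipticCurves.Sprung2017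
  Literature.NumberTheory.EllipticCurves.Kobayashi2003
  Literature.NumberTheory.EllipticCurves.GreenbergVatsal2000
  Literature.NumberTheory.EllipticCurves.Rank1Residual
  Summit.BirchSwinnertonDyer.Rank1Residual.X1.MuLambda
  Summit.BirchSwinnertonDyer.Rank1Residual.Supersingular
  Summit.BirchSwinnertonDyer.BirchSwinnertonDyer.Theorems.PrintX8MazurTateMuRider
  Summit.BirchSwinnertonDyer.BirchSwinnertonDyer.Theorems.PrintX8MazurTateThreeCollapse
  Summit.BirchSwinnertonDyer.BirchSwinnertonDyer.Theorems.PrintX8LayeredStevensCollapse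
  Summit.BirchSwinnertonDyer.BirchSwinnertonDyer.Theorems.SmallImageLowerHalfBothSignsMuRiderNode
  Summit.BirchSwinnertonDyer.BirchSwinnertonDyer.Theorems.SmallImageLowerHalfBothSignsMuRiderTwoParityLayersThree

namespace Summit.BirchSwinnertonDyer.BirchSwinnertonDyer.Theorems.SmallImageLowerHalfBothSignsMuRiderParitySpanThree

/-! ## §0 The two parity halves of THEOREM B's generating set (any `N`, any `p`) -/

section SetAlgebra

variable {N : ℕ}

/-- `IsGoodAt (p²) γ` («`|d_γ|` is a power of `p²`») is «`|d_γ| = p^{2m}` for some `m`»: the EVEN-layer good elements of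
`Γ₀(N)` (`γ·0 = b/d` is a cusp of even exact layer). [cite: Sun2007, §4 (the map j_n)] -/
theorem isGoodAt_sq_iff (p : ℕ) (γ : Gamma0 N) :
    IsGoodAt (p ^ 2) γ ↔ ∃ m : ℕ, (dEntry γ).natAbs = p ^ (2 * m) := by
  simp only [IsGoodAt, ← pow_mul]

/-- The even half as a set: `{γ | IsGoodAt (p²) γ} = {γ | ∃ m, |d_γ| = p^{2m}}`. [cite: Sun2007, §4 (the map j_n)] -/
theorem setOf_isGoodAt_sq_eq (N p : ℕ) :
    {γ : Gamma0 N | IsGoodAt (p ^ 2) γ} = {γ : Gamma0 N | ∃ m : ℕ, (dEntry γ).natAbs = p ^ (2 * m)} := by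
  ext γ
  exact isGoodAt_sq_iff p γ

/-- THEOREM B's good set splits by the parity of the layer:
`{γ | IsGoodAt p γ} = {γ | IsGoodAt (p²) γ} ∪ {γ | ∃ m, |d_γ| = p^{2m+1}}`. [cite: Sun2007, §4 (the map j_n)] -/
theorem setOf_isGoodAt_eq_union (N p : ℕ) :
    {γ : Gamma0 N | IsGoodAt p γ} =
      {γ : Gamma0 N | IsGoodAt (p ^ 2) γ} ∪ {γ : Gamma0 N | ∃ m : ℕ, (dEntry γ).natAbs = p ^ (2 * m + 1)} := by
  ext γ
  simp only [Set.mem_setOf_eq, Set.mem_union]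
  rw [isGoodAt_sq_iff]
  simp only [IsGoodAt]
  constructor
  · rintro ⟨m, hm⟩
    rcases Nat.even_or_odd m with ⟨k, rfl⟩ | ⟨k, rfl⟩
    · exact Or.inl ⟨k, by rw [hm, two_mul]⟩
    · exact Or.inr ⟨k, by rw [hm]⟩
  · rintro (⟨m, hm⟩ | ⟨m, hm⟩)
    · exact ⟨2 * m, hm⟩
    · exact ⟨2 * m + 1, hm⟩

/-- An even exact layer lies in the even half. [cite: Sun2007, §4 (the map j_n)] -/
theorem goodLayer_two_mul_subset (N p m : ℕ) :
    goodLayer N p (2 * m) ⊆ {γ : Gamma0 N | IsGoodAt (p ^ 2) γ} :=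
  fun γ hγ ↦ (isGoodAt_sq_iff p γ).mpr ⟨m, hγ⟩

/-- An odd exact layer lies in the odd half. [cite: Sun2007, §4 (the map j_n)] -/
theorem goodLayer_two_mul_add_one_subset (N p m : ℕ) :
    goodLayer N p (2 * m + 1) ⊆ {γ : Gamma0 N | ∃ k : ℕ, (dEntry γ).natAbs = p ^ (2 * k + 1)} :=
  fun _ hγ ↦ ⟨m, hγ⟩

/-- **ONE certified EVEN layer ⟹ the even half spans** (`SpanModBy` is monotone in the test set).
[cite: Sun2007, §4 (8)] [cite: Manin1972, Prop. 1.4] -/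
theorem spanModBy_even_of_layerEisSpanModGen {N p m : ℕ} (hm : Even m) (h : LayerEisSpanModGen N p m) :
    SpanModBy N p {γ : Gamma0 N | IsGoodAt (p ^ 2) γ} := by
  obtain ⟨k, rfl⟩ := hm
  have hsub : goodLayer N p (k + k) ⊆ {γ : Gamma0 N | IsGoodAt (p ^ 2) γ} := by
    rw [← two_mul]
    exact goodLayer_two_mul_subset N p k
  exact SpanModBy.mono hsub ((spanModBy_goodLayer_iff N p _).mpr h)

/-- **ONE certified ODD layer ⟹ the odd half spans.** [cite: Sun2007, §4 (8)] [cite: Manin1972, Prop. 1.4] -/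
theorem spanModBy_odd_of_layerEisSpanModGen {N p m : ℕ} (hm : Odd m) (h : LayerEisSpanModGen N p m) :
    SpanModBy N p {γ : Gamma0 N | ∃ k : ℕ, (dEntry γ).natAbs = p ^ (2 * k + 1)} := by
  obtain ⟨k, rfl⟩ := hm
  exact SpanModBy.mono (goodLayer_two_mul_add_one_subset N p k) ((spanModBy_goodLayer_iff N p _).mpr h)

/-- **Two consecutive certified layers (`LayerEisSpanTwoModGen`, the x8 / gen-2 hypothesis) ⟹ BOTH halves span** — one of
`m, m + 1` is even, the other odd. [cite: Sun2007, §4 (8)] [cite: Manin1972, Prop. 1.4] -/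
theorem spanModBy_parity_of_layerEisSpanTwoModGen {N p : ℕ} (h : LayerEisSpanTwoModGen N p) :
    SpanModBy N p {γ : Gamma0 N | IsGoodAt (p ^ 2) γ} ∧
      SpanModBy N p {γ : Gamma0 N | ∃ k : ℕ, (dEntry γ).natAbs = p ^ (2 * k + 1)} := by
  obtain ⟨m, -, h1, h2⟩ := h
  rcases Nat.even_or_odd m with hm | hm
  · exact ⟨spanModBy_even_of_layerEisSpanModGen hm h1, spanModBy_odd_of_layerEisSpanModGen hm.add_one h2⟩
  · exact ⟨spanModBy_even_of_layerEisSpanModGen hm.add_one h2, spanModBy_odd_of_layerEisSpanModGen hm h1⟩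

/-- **THEOREM B (tree theorem, Vaserstein over `ℤ[1/p]`) = «the UNION of the two halves spans»**, input-free, for every
prime `p ∤ N`: `SpanModBy N p (S_even ∪ S_odd)`.  The parity road asks for each half separately.
[cite: Vaserstein1972SL2, Theorem (p. 313)] [cite: Manin1972, Prop. 1.4] -/
theorem spanModBy_union_parity {N p : ℕ} (hp : p.Prime) (hpN : ¬ p ∣ N) :
    SpanModBy N p ({γ : Gamma0 N | IsGoodAt (p ^ 2) γ} ∪
      {γ : Gamma0 N | ∃ m : ℕ, (dEntry γ).natAbs = p ^ (2 * m + 1)}) := by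
  rw [← setOf_isGoodAt_eq_union, spanModBy_setOf_isGoodAt_iff]
  exact eisSpanModGen_of_conjSpanGen
    (ConjSpanGenAllLevels.conjSpanGenAll_of_vaserstein_away
      Literature.NumberTheory.Automorphic.SL2Rel.Away.relG_le_relE_span_natCast N p hp hpN)

end SetAlgebra

/-! ## §1 Each half gives a UNIT winding symbol at a layer of that parity (`p` odd; x8's PROVED bridge `bridgeBy`) -/

section Bridge

variable (W : WeierstrassCurve ℚ) [W.IsElliptic] [W.IsGloballyMinimal] (p : ℕ) [hp : Fact p.Prime]
  {N : ℕ} [NeZero N] (f : CuspForm (Gamma0 N) 2)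

/-- **Generic layer-shape bridge.**  For a newform `f` of `E = W` (level `N`), `p` odd of good reduction with
`a_p ≢ 1 (mod p)`, and an exponent shape `e : ℕ → ℕ`: if the test set `{γ : |d_γ| = p^{e m} for some m}` spans
(`SpanModBy`), then some layer `e m ≥ 1` carries a UNIT difference `[b/p^{e m}]⁺_f − [0]⁺_f` with `p ∤ b`.  x8's `bridgeBy`
gives `γ` in the test set with a unit difference at `γ·0 = b/d`, `d = ±p^{e m}`; `e m = 0` is impossible (`γ·0 ∈ ℤ` and
`[·]⁺_f` is `ℤ`-periodic, `ratPlusSymbol_add_intCast_eq`), and `p ∤ b` since `ad − bc = 1`.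
[cite: MazurTateTeitelbaum1986Invent, §I.10 (10.1)] [cite: Manin1972, Prop. 1.4] -/
theorem exists_unit_layer_of_spanModBy_shape (hf : IsNewformOf W f) (hp2 : p ≠ 2)
    (hgood : W.HasGoodReductionAtPrime p) (hap1 : ¬ ((p : ℤ) ∣ W.frobeniusTrace p - 1)) (e : ℕ → ℕ)
    (hS : SpanModBy N p {γ : Gamma0 N | ∃ m : ℕ, (dEntry γ).natAbs = p ^ (e m)}) :
    ∃ (m : ℕ) (b : ℤ), 1 ≤ e m ∧ ¬ (p : ℤ) ∣ b ∧
      1 ≤ ‖((ratPlusSymbol f ((b : ℚ) / (p : ℚ) ^ (e m)) - ratPlusSymbol f 0 : ℚ) : ℚ_[p])‖ := by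
  have hpP : p.Prime := Fact.out
  have hpN : ¬ p ∣ N := not_dvd_level_of_isNewformOf hf hgood
  have h2N : ¬ p ∣ 2 * N := by
    intro h
    rcases (Nat.Prime.dvd_mul hpP).mp h with h2 | hN
    · exact hp2 ((Nat.prime_dvd_prime_iff_eq hpP Nat.prime_two).mp h2)
    · exact hpN hN
  obtain ⟨γ, ⟨m, hm⟩, hunit⟩ := PrintX8VerticalStevens.bridgeBy W p f hf h2N hap1 _ hS
  have hd : ((γ : SL(2, ℤ)) 1 1 : ℤ) = (p : ℤ) ^ (e m) ∨ ((γ : SL(2, ℤ)) 1 1 : ℤ) = -((p : ℤ) ^ (e m)) := by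
    have := Int.natAbs_eq_iff.mp hm
    push_cast at this
    simpa [dEntry] using this
  -- the layer `e m` is positive: at layer `0` the cusp `γ·0 = ±b` is an integer and the difference vanishes
  have hem : 1 ≤ e m := by
    by_contra hlt
    have h0 : e m = 0 := by omega
    have hzero : ratPlusSymbol f ((((γ : SL(2, ℤ)) 0 1 : ℤ) : ℚ) / (((γ : SL(2, ℤ)) 1 1 : ℤ) : ℚ)) =
        ratPlusSymbol f 0 := by
      rcases hd with hd | hd
      · rw [hd, h0, pow_zero, Int.cast_one, div_one]
        simpa using ratPlusSymbol_add_intCast_eq f 0 ((γ : SL(2, ℤ)) 0 1)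
      · rw [hd, h0, pow_zero, Int.cast_neg, Int.cast_one, div_neg, div_one]
        simpa using ratPlusSymbol_add_intCast_eq f 0 (-((γ : SL(2, ℤ)) 0 1))
    rw [hzero, sub_self, Rat.cast_zero, norm_zero] at hunit
    exact absurd hunit (by norm_num)
  have hdet : ((γ : SL(2, ℤ)) 0 0 : ℤ) * ((γ : SL(2, ℤ)) 1 1 : ℤ) -
      ((γ : SL(2, ℤ)) 0 1 : ℤ) * ((γ : SL(2, ℤ)) 1 0 : ℤ) = 1 := by
    have := Matrix.SpecialLinearGroup.det_coe (γ : SL(2, ℤ))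
    rw [Matrix.det_fin_two] at this
    linear_combination this
  have hpZ : Prime (p : ℤ) := Nat.prime_iff_prime_int.mp hpP
  have hpd : (p : ℤ) ∣ ((γ : SL(2, ℤ)) 1 1 : ℤ) := by
    have hpk : (p : ℤ) ∣ (p : ℤ) ^ (e m) := dvd_pow_self _ (by omega)
    rcases hd with hd | hd <;> rw [hd]
    · exact hpk
    · exact hpk.neg_right
  have hpb : ¬ (p : ℤ) ∣ ((γ : SL(2, ℤ)) 0 1 : ℤ) := by
    intro hpb
    have : (p : ℤ) ∣ 1 := by
      rw [← hdet]
      exact dvd_sub (hpd.mul_left _) (hpb.mul_right _)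
    exact hpZ.not_dvd_one this
  rcases hd with hd | hd
  · refine ⟨m, ((γ : SL(2, ℤ)) 0 1 : ℤ), hem, hpb, ?_⟩
    have e1 : (((γ : SL(2, ℤ)) 0 1 : ℤ) : ℚ) / (p : ℚ) ^ (e m) =
        (((γ : SL(2, ℤ)) 0 1 : ℤ) : ℚ) / (((γ : SL(2, ℤ)) 1 1 : ℤ) : ℚ) := by
      rw [hd]; push_cast; rfl
    rw [e1]; exact hunit
  · refine ⟨m, -((γ : SL(2, ℤ)) 0 1 : ℤ), hem, fun h ↦ hpb (dvd_neg.mp h), ?_⟩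
    have e1 : (((-((γ : SL(2, ℤ)) 0 1 : ℤ) : ℤ)) : ℚ) / (p : ℚ) ^ (e m) =
        (((γ : SL(2, ℤ)) 0 1 : ℤ) : ℚ) / (((γ : SL(2, ℤ)) 1 1 : ℤ) : ℚ) := by
      rw [hd]; push_cast; rw [div_neg, neg_div]
    rw [e1]; exact hunit

/-- **Even half ⟹ a unit symbol at an EVEN layer `2m ≥ 2`** (`p` odd good, `a_p ≢ 1`, `f` a newform of `W`).
[cite: MazurTateTeitelbaum1986Invent, §I.10 (10.1)] [cite: Sun2007, §4] -/
theorem exists_unit_evenLayer_of_spanModBy (hf : IsNewformOf W f) (hp2 : p ≠ 2)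
    (hgood : W.HasGoodReductionAtPrime p) (hap1 : ¬ ((p : ℤ) ∣ W.frobeniusTrace p - 1))
    (hS : SpanModBy N p {γ : Gamma0 N | IsGoodAt (p ^ 2) γ}) :
    ∃ (m : ℕ) (b : ℤ), 1 ≤ m ∧ ¬ (p : ℤ) ∣ b ∧
      1 ≤ ‖((ratPlusSymbol f ((b : ℚ) / (p : ℚ) ^ (2 * m)) - ratPlusSymbol f 0 : ℚ) : ℚ_[p])‖ := by
  rw [setOf_isGoodAt_sq_eq] at hS
  obtain ⟨m, b, hm, hb, h⟩ := exists_unit_layer_of_spanModBy_shape W p f hf hp2 hgood hap1 (fun m ↦ 2 * m) hS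
  exact ⟨m, b, by omega, hb, h⟩

/-- **Odd half ⟹ a unit symbol at an ODD layer `2m + 1`** (`p` odd good, `a_p ≢ 1`, `f` a newform of `W`).
[cite: MazurTateTeitelbaum1986Invent, §I.10 (10.1)] [cite: Sun2007, §4] -/
theorem exists_unit_oddLayer_of_spanModBy (hf : IsNewformOf W f) (hp2 : p ≠ 2)
    (hgood : W.HasGoodReductionAtPrime p) (hap1 : ¬ ((p : ℤ) ∣ W.frobeniusTrace p - 1))
    (hS : SpanModBy N p {γ : Gamma0 N | ∃ k : ℕ, (dEntry γ).natAbs = p ^ (2 * k + 1)}) :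
    ∃ (m : ℕ) (b : ℤ), ¬ (p : ℤ) ∣ b ∧
      1 ≤ ‖((ratPlusSymbol f ((b : ℚ) / (p : ℚ) ^ (2 * m + 1)) - ratPlusSymbol f 0 : ℚ) : ℚ_[p])‖ := by
  obtain ⟨m, b, -, hb, h⟩ :=
    exists_unit_layer_of_spanModBy_shape W p f hf hp2 hgood hap1 (fun m ↦ 2 * m + 1) hS
  exact ⟨m, b, hb, h⟩

end Bridge

/-! ## §2 `p = 3`, `a₃ = 0`: one unit layer of given PARITY ⟹ one COLOUR -/

section Three

variable {W : WeierstrassCurve ℚ} [W.IsElliptic] [W.IsGloballyMinimal] {N : ℕ} [NeZero N]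
  {f : CuspForm (Gamma0 N) 2} {p : ℕ} [hp : Fact p.Prime]

/-- **One unit layer `n + 1` ⟹ an integral model `Θ` of the Mazur–Tate element `θ_n` with `Θ ≠ 0`, `μ(Θ) = 0`**
(`p = 3` good, `a₃ = 0`, `f` any newform of `W`, in the NON-unit case `‖[0]⁺_f‖₃ < 1`): all symbols are `3`-integral
(`a₃ = 0 ≢ 1`), so the ultrametric pinch makes `[b/3^{n+1}]⁺_f` itself a unit and the integral model of `θ_n` is `≢ 0 (mod 3)`.
Gen 2's inner step (`…TwoParityLayersThree`, `hlayer`) stated on its own. [cite: MazurTateTeitelbaum1986Invent, §I.10 (10.1)]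
[cite: Pollack2003, Prop. 6.18] -/
theorem exists_integral_mazurTate_of_unitLayer_three (hp3 : p = 3) (hgood : W.HasGoodReductionAtPrime p)
    (hap0 : W.frobeniusTrace p = 0) (hf : IsNewformOf W f) (h0lt : ‖((ratPlusSymbol f 0 : ℚ) : ℚ_[p])‖ < 1)
    (n : ℕ) {b : ℤ} (hb : ¬ (p : ℤ) ∣ b)
    (h : 1 ≤ ‖((ratPlusSymbol f ((b : ℚ) / (p : ℚ) ^ (n + 1)) - ratPlusSymbol f 0 : ℚ) : ℚ_[p])‖) :
    ∃ Θ : IwasawaAlgebra p, iwasawaToPowerSeries p Θ =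
      ((mazurTateElement f p n).map (algebraMap ℚ ℚ_[p]) : PowerSeries ℚ_[p]) ∧ Θ ≠ 0 ∧ mu Θ = 0 := by
  subst hp3
  have hp2 : (3 : ℕ) ≠ 2 := by decide
  have hf0 : IsNewform0 f := hf.1
  have hpN : ¬ 3 ∣ N := not_dvd_level_of_isNewformOf hf hgood
  have hap : cuspCoeff f 3 = ((W.frobeniusTrace 3 : ℤ) : ℂ) :=
    cuspCoeff_eq_frobeniusTrace_of_isNewformOf_holds hf hgood
  have hpa : ¬ ((3 : ℕ) : ℤ) ∣ W.frobeniusTrace 3 - 1 := by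
    rw [hap0]
    norm_num
  have he : cyclotomicExponent 3 = 1 := if_neg hp2
  have hu : ‖((ratPlusSymbol f ((((b : ZMod (3 ^ (n + 1))).val : ℕ) : ℚ) /
      ((3 : ℕ) : ℚ) ^ (n + 1)) : ℚ) : ℚ_[3])‖ = 1 := by
    rw [← ratPlusSymbol_intCast_div_pow_eq_val f 3 (n + 1) b]
    rw [Rat.cast_sub] at h
    exact norm_eq_one_of_one_le_norm_sub 3
      (by rw [ratPlusSymbol_intCast_div_pow_eq_val f 3 (n + 1) b]
          exact norm_ratPlusSymbol_div_pow_le_one_of_not_dvd hp2 hf0 hpN hap hpa _ _) h0lt h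
  obtain ⟨P, hP⟩ := exists_map_eq_map_mazurTateElement_of_not_dvd hp2 hf0 hpN hap hpa n
  have hΘ : iwasawaToPowerSeries 3 (P : PowerSeries ℤ_[3]) =
      ((mazurTateElement f 3 n).map (algebraMap ℚ ℚ_[3]) : PowerSeries ℚ_[3]) := by
    rw [← hP, Polynomial.polynomial_map_coe]
  have hred : red (P : PowerSeries ℤ_[3]) ≠ 0 :=
    red_ne_zero_of_mazurTate_of_norm_ratPlusSymbol_eq_one f rfl hf0 hpN hap hpa hΘ
      (not_dvd_val_intCast 3 (L := n + 1) (by omega) hb) (by rw [he]; exact hu)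
  exact ⟨(P : PowerSeries ℤ_[3]), hΘ, ne_zero_of_red_ne_zero hred,
    (mu_eq_zero_and_lam_eq_of_red_ne_zero hred).1⟩

/-- **A unit symbol at an EVEN layer `m ≥ 2` ⟹ `L♯ ≢ 0 (mod 3)`** (`p = 3` good, `a₃ = 0`, `f` any newform, ANY Sprung
pair; `L♯ = L⁺` for `a₃ = 0`).  Unit case `ord₃ [0]⁺_f = 0`: both colours are units (`isUnit_chromaticL_of_frobeniusTrace_eq_zero`);
otherwise the layer-`m` unit is an integral `θ_{m−1} ≢ 0` with `m − 1` ODD, and x8's `red_sharp_ne_zero_of_mazurTate_odd`.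
[cite: Pollack2003, Prop. 6.9, Prop. 6.10 and Def. 6.15] [cite: Sprung2017, §3.1, Cor. 4.4 and Cor. 4.11] -/
theorem red_sharp_ne_zero_of_unit_evenLayer_three (hp3 : p = 3) (hgood : W.HasGoodReductionAtPrime p)
    (hap0 : W.frobeniusTrace p = 0) (hf : IsNewformOf W f)
    {Lsharp Lflat : IwasawaAlgebra p} (hSP : IsSprungPair f p (W.frobeniusTrace p) Lsharp Lflat)
    {m : ℕ} (hm : 1 ≤ m) (hme : Even m) {b : ℤ} (hb : ¬ (p : ℤ) ∣ b)
    (h : 1 ≤ ‖((ratPlusSymbol f ((b : ℚ) / (p : ℚ) ^ m) - ratPlusSymbol f 0 : ℚ) : ℚ_[p])‖) :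
    red Lsharp ≠ 0 := by
  have hp2 : p ≠ 2 := by omega
  have hap3 : (p : ℤ) ∣ W.frobeniusTrace p := by rw [hap0]; exact dvd_zero _
  by_cases h0 : ‖((ratPlusSymbol f 0 : ℚ) : ℚ_[p])‖ = 1
  · -- unit case: `L♯` is a unit of `Λ`
    have hr : ratPlusSymbol f 0 ≠ 0 := by
      intro hz
      rw [hz, Rat.cast_zero, norm_zero] at h0
      exact zero_ne_one h0
    have hv : padicValRat p (ratPlusSymbol f 0) = 0 := by
      have hpR : (1 : ℚ) < p := by exact_mod_cast hp.out.one_lt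
      rw [Padic.eq_padicNorm, padicNorm.eq_zpow_of_nonzero hr] at h0
      have h0' : ((p : ℚ) ^ (-padicValRat p (ratPlusSymbol f 0)) : ℚ) = 1 := by exact_mod_cast h0
      have h3 := (zpow_eq_one_iff_right₀ (by positivity : (0 : ℚ) ≤ p) hpR.ne').mp h0'
      omega
    have hu := (isUnit_chromaticL_of_frobeniusTrace_eq_zero hp2 hf hgood hap0 hSP .sharp hr hv).map
      (PowerSeries.map (IsLocalRing.residue ℤ_[p]))
    rw [chromaticL_sharp] at hu
    exact hu.ne_zero
  · have h0lt : ‖((ratPlusSymbol f 0 : ℚ) : ℚ_[p])‖ < 1 := by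
      refine lt_of_le_of_ne ?_ h0
      subst hp3
      have h' := norm_ratPlusSymbol_div_pow_le_one_of_not_dvd (by decide) hf.1
        (not_dvd_level_of_isNewformOf hf hgood) (cuspCoeff_eq_frobeniusTrace_of_isNewformOf_holds hf hgood)
        (by rw [hap0]; norm_num) 0 0
      simpa using h'
    obtain ⟨n, rfl⟩ : ∃ n, m = n + 1 := ⟨m - 1, by omega⟩
    have hn : Odd n := by
      rcases Nat.even_or_odd n with hn | hn
      · exfalso
        obtain ⟨a, ha⟩ := hme
        obtain ⟨c, hc⟩ := hn
        omega
      · exact hn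
    obtain ⟨Θ, hΘ, hΘ0, hμ⟩ := exists_integral_mazurTate_of_unitLayer_three hp3 hgood hap0 hf h0lt n hb h
    exact red_sharp_ne_zero_of_mazurTate_odd hp2 hf hgood hap3 hSP hn hΘ hΘ0 hμ

/-- **A unit symbol at an ODD layer `m` ⟹ `L♭ ≢ 0 (mod 3)`** (`L♭ = L⁻` for `a₃ = 0`; `m − 1` EVEN, x8's
`red_flat_ne_zero_of_mazurTate_even`). [cite: Pollack2003, Prop. 6.9, Prop. 6.10 and Def. 6.15] [cite: Sprung2017, §3.1, Cor. 4.4 and Cor. 4.11] -/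
theorem red_flat_ne_zero_of_unit_oddLayer_three (hp3 : p = 3) (hgood : W.HasGoodReductionAtPrime p)
    (hap0 : W.frobeniusTrace p = 0) (hf : IsNewformOf W f)
    {Lsharp Lflat : IwasawaAlgebra p} (hSP : IsSprungPair f p (W.frobeniusTrace p) Lsharp Lflat)
    {m : ℕ} (hmo : Odd m) {b : ℤ} (hb : ¬ (p : ℤ) ∣ b)
    (h : 1 ≤ ‖((ratPlusSymbol f ((b : ℚ) / (p : ℚ) ^ m) - ratPlusSymbol f 0 : ℚ) : ℚ_[p])‖) :
    red Lflat ≠ 0 := by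
  have hp2 : p ≠ 2 := by omega
  have hap3 : (p : ℤ) ∣ W.frobeniusTrace p := by rw [hap0]; exact dvd_zero _
  by_cases h0 : ‖((ratPlusSymbol f 0 : ℚ) : ℚ_[p])‖ = 1
  · have hr : ratPlusSymbol f 0 ≠ 0 := by
      intro hz
      rw [hz, Rat.cast_zero, norm_zero] at h0
      exact zero_ne_one h0
    have hv : padicValRat p (ratPlusSymbol f 0) = 0 := by
      have hpR : (1 : ℚ) < p := by exact_mod_cast hp.out.one_lt
      rw [Padic.eq_padicNorm, padicNorm.eq_zpow_of_nonzero hr] at h0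
      have h0' : ((p : ℚ) ^ (-padicValRat p (ratPlusSymbol f 0)) : ℚ) = 1 := by exact_mod_cast h0
      have h3 := (zpow_eq_one_iff_right₀ (by positivity : (0 : ℚ) ≤ p) hpR.ne').mp h0'
      omega
    have hu := (isUnit_chromaticL_of_frobeniusTrace_eq_zero hp2 hf hgood hap0 hSP .flat hr hv).map
      (PowerSeries.map (IsLocalRing.residue ℤ_[p]))
    rw [chromaticL_flat] at hu
    exact hu.ne_zero
  · have h0lt : ‖((ratPlusSymbol f 0 : ℚ) : ℚ_[p])‖ < 1 := by
      refine lt_of_le_of_ne ?_ h0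
      subst hp3
      have h' := norm_ratPlusSymbol_div_pow_le_one_of_not_dvd (by decide) hf.1
        (not_dvd_level_of_isNewformOf hf hgood) (cuspCoeff_eq_frobeniusTrace_of_isNewformOf_holds hf hgood)
        (by rw [hap0]; norm_num) 0 0
      simpa using h'
    obtain ⟨n, rfl⟩ : ∃ n, m = n + 1 := ⟨m - 1, by obtain ⟨c, hc⟩ := hmo; omega⟩
    have hn : Even n := by
      rcases Nat.even_or_odd n with hn | hn
      · exact hn
      · exfalso
        obtain ⟨a, ha⟩ := hmo
        obtain ⟨c, hc⟩ := hn
        omega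
    obtain ⟨Θ, hΘ, hΘ0, hμ⟩ := exists_integral_mazurTate_of_unitLayer_three hp3 hgood hap0 hf h0lt n hb h
    exact red_flat_ne_zero_of_mazurTate_even hp2 hf hgood hap3 hSP hn hΘ hΘ0 hμ

end Three

end Summit.BirchSwinnertonDyer.BirchSwinnertonDyer.Theorems.SmallImageLowerHalfBothSignsMuRiderParitySpanThree

end
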